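import Literature.Combinatorics.Words.RepetitiveMappings
import Literature.Combinatorics.Hypergraph.RamseyTheorem
import HarnessLib

/-!
# Lothaire 1997, Theorem 4.1.3 (Ramsey's theorem): the named fact discharged

`Literature/Combinatorics/Words/RepetitiveMappings.lean` transcribes §4.1 of Lothaire,
*Combinatorics on Words* (1997), where **Theorem 4.1.3** — Ramsey's theorem for `r`-subsets with
`n` colours, "for `k ≥ r ≥ 1` there is `R = R(r, k, n)` such that every `n`-colouring of the
`r`-subsets of a set with at least `R` elements has a `k`-subset all of whose `r`-subsets get the
same colour" — is STATED WITHOUT PROOF (the text refers to Ramsey 1930 and Graham–Rothschild–Spencer)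
and was recorded there as the named fact `RamseyTheorem` (with `IsRamseyBound r k E R` the bound
property); only the pair case `r = 2` used by Theorem 4.1.4 was proved (`exists_isRamseyPairBound`).

This file DISCHARGES the fact: `RamseyTheorem_holds : RamseyTheorem`, from the hypergraph Ramsey
theorem of the tree, `Literature.Combinatorics.Hypergraph.exists_ramsey` /
`exists_ramsey_finite` (`Literature/Combinatorics/Hypergraph/RamseyTheorem.lean`, proved by the
recursion `R_n^{(r)}(k₁,…,kₙ) ≤ R_n^{(r-1)}(R_n^{(r)}(k₁-1,…),…,R_n^{(r)}(…,kₙ-1)) + 1` of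
Bollobás, *Graph Theory*, Ch. VI Thm. 2 / p. 107). The hypotheses `1 ≤ r ≤ k` of the fact are not
needed (`exists_isRamseyBound` gives a bound for all `r, k` and every finite colour set).

## References

* [Lothaire1997] M. Lothaire, *Combinatorics on Words*, Cambridge Mathematical Library (1997),
  §4.1, Theorem 4.1.3.
* [GrahamRothschildSpencer1990] R. L. Graham, B. L. Rothschild, J. H. Spencer, *Ramsey Theory*,
  2nd ed. (1990), §1.2 Theorem 2.
* [Bollobas1979] B. Bollobás, *Graph Theory*, GTM 63 (1979), Ch. VI §1 Theorem 2, p. 107.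
-/

namespace Literature.Combinatorics.Words

/-- **Theorem 4.1.3 (Ramsey), all parameters**: for every `r`, `k` and every finite colour set `E`
there is an `R` with `IsRamseyBound r k E R` — every `E`-colouring of finsets of naturals has, inside
any `X : Finset ℕ` with `R ≤ |X|`, a `k`-subset all of whose `r`-subsets get one colour. (The text's
restriction `k ≥ r ≥ 1` is unnecessary.) From `Literature.Combinatorics.Hypergraph.exists_ramsey_finite`.
[cite: Lothaire1997, Theorem 4.1.3 (Ramsey)] [cite: GrahamRothschildSpencer1990, §1.2 Theorem 2] -/
theorem exists_isRamseyBound (r k : ℕ) (E : Type*) [Finite E] : ∃ R : ℕ, IsRamseyBound r k E R := by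
  obtain ⟨N, hN⟩ : ∃ N : ℕ, ∀ {α : Type} (X : Finset α), N ≤ X.card → ∀ c : Finset α → E,
      ∃ Y ⊆ X, Y.card = k ∧ ∃ e : E, ∀ Z ∈ Y.powersetCard r, c Z = e :=
    Literature.Combinatorics.Hypergraph.exists_ramsey_finite r k E
  exact ⟨N, fun X hX c => hN X hX c⟩

/-- **DISCHARGE of the named fact `RamseyTheorem`** (Lothaire 1997, Theorem 4.1.3, stated there
without proof): `R(r, k, n)` exists for all `k ≥ r ≥ 1` and all `n` — in fact for all `r, k, n`,
by `exists_isRamseyBound` (the hypergraph Ramsey theorem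
`Literature.Combinatorics.Hypergraph.exists_ramsey`, Bollobás Ch. VI Thm. 2 recursion).
[cite: Lothaire1997, Theorem 4.1.3 (Ramsey)] [cite: GrahamRothschildSpencer1990, §1.2 Theorem 2]
[cite: Bollobas1979, Ch. VI §1, Theorem 2 and p. 107] -/
theorem RamseyTheorem_holds : RamseyTheorem :=
  fun r k n _ _ => exists_isRamseyBound r k (Fin n)

end Literature.Combinatorics.Words
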